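import Literature.MathematicalPhysics.QuantumFieldTheory.Balaban1983to89.B9SectBGpTransferInY

/-!
# `Balaban1983to89.B9SectBGpTransferOutY` — the OUTPUT HALF of the transfer between the augmented coded readings `KSC` and the record's (3.42) readings
# of G′, PLUMBING: at a coded product `U′U` the block of `KSC` and a CONVERTED (3.42) block of the record's family (letters at `U′U`) give the record's
# block read along the decoding — the three letter conversions `∇_U ↦ ∇_{U′U}` (left), `∇*_U ↦ ∇*_{U′U}` (right), `Δ_U ↦ Δ_{U′U}` are the ONE displayed hypothesis

T. Bałaban, *Propagators for lattice gauge theories in a background field*, Commun. Math. Phys. **99** (1985) 389–434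
[`Balaban1985BackgroundPropagators`, "B9"].

statement-level skeleton of published theorems with citation tags; proofs where landed; nothing here is a claim about the
Yang–Mills mass gap

THE PRINTED LOCI.  Thm 3.4 p. 400 + p. 403 («we can prove all the statements (3.42)–(3.47) of Theorem 3.1 for the operator G′(U′U), of course with different
constants»);
p. 403 l.1–9 (the letters ∇_{U′U}); (3.70) p. 404; Thms 3.1–3.3 (3.42)–(3.48) pp. 397–399.

WHY THIS FILE (pub-ymgap N06 row 13, seat dag-n06-c gen 7).  `B9SectBStepFamilyTransfer.sectBStepPrinted_of_family` moves `B9.SectBStepPrinted` from the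
augmented readings `KSC` (for which the Sect.-B frames are inhabited) to the record's family read along the decoding; its `hin` is `B9SectBGpTransferInY.hin_KSC`;
its `hout` asks, at a regular `U` and a class member `U′ = e^{ηa}`: `Thms31to33IneqAt … (KSC …) … t (prod U a) → Thms31to33IneqAt … (pullK …) … t″ (prod U a)`.
The Hölder ∕ (3.44)–(3.45) ∕ L² ∕ global members of both families at `prod U a` ARE the record's at `W = U′U` (§1, `rfl`); the `GA`, `C` blocks are shared; so
`hout` REDUCES (§2 ★★ `thms_pullK_prod_of_KSC`) to ONE analytic statement per `(U, a)`: the record's (3.42) block AT `W` with letters AT `W`,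
`EBlock (kernelFamilyS … (GpY par) par) B″ δ″ W`, from the block of `KSC` at `prod U a` (letters at the base `U`) — the three letter conversions of p. 403,
left for the next file (design: LEFT and LAPLACIAN by `∇_{U′U} = ∇_U + (Ad U′ − 1)∘τ_U` and `Δ′_{U′U} = Δ′_U + V′(A′)` with the (3.37) smallness at the
OUTPUT block; RIGHT by the same at the INPUT block plus the level gap of the geometry, at the cost of halving the decay rate).  §3 begins it: the LEFT
letter at `W = U′U` pointwise, ★ `cdS_mulY_apply` (`∇_{W,μ}g(z) = ∇_{U,μ}g(z) + (R(U′_μ(z)) − 1)R(U_μ(z))g(z+e_μ)`, exact) and ★ `eta_mul_norm_cdS_mulY_le` (its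
norm form with the transport defect `‖U′−1‖‖U′⁻¹‖ + ‖U′⁻¹−1‖` at the OUTPUT bond — to be fed by (3.37) and the first entry at the neighbour block).

HONEST SCOPE.  Bookkeeping (`rfl` member identities and monotonicity of the blocks in `(B₀, δ₀)`); the conversion is a HYPOTHESIS; no estimate of [B9] is
proved or asserted; the block labels `ιB` are a SECTION of `β` (`hι`), which exists exactly at the
CORNER-FREE members (`B9BetaRangeKLevelV1.surjective_beta_iff`) — at a cornered member every statement displaying `hι` is vacuous (ref-E READ-1∕10; a
quasi-section at bounded distance would serve the same estimates with larger constants, not done); COUNT-NEUTRAL; N06 NOT discharged; one finite lattice programme — nothing continuum ∕ OS ∕ mass-gap ∕ Clay.  Cell `pub-ymgap` (HUMAN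
RULING D-0062), Track A node N06 [B9], N06-ASSIGNMENT row 13, 2026-08-27.

RELATED IN THE TREE, NOT DUPLICATED: `B9SectBGpTransferInY` (the input half, `ineq342_346_347_mono`, `ineq343_345_congr`), `B9Eq370Expansion` ∕
`B9Eq371Composition` (r06's (3.70)–(3.71) at the level of `prodCfg`; here the product is `mulY` on NODE 00's chart and only the one-line transport identity is used), `B9SectBGpReadingsY` (`KSC`),
`B9SectBCodedCarrier` (`pullK`, `CCfg`), `B9SectBGpFrameCodedY` (`codingYx`), `B9Eq360DeltaPrimeAY` (`mulY`), `B9SectBStepFamilyTransfer` (the consumer).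
-/

noncomputable section

namespace Literature.MathematicalPhysics.QuantumFieldTheory.Balaban1983to89.B9SectBGpTransferOutY

open Literature.MathematicalPhysics.QuantumFieldTheory.Balaban1983to89.B6KLevelCensusIndexV1 (KIdx kGeo)
open Literature.MathematicalPhysics.QuantumFieldTheory.Balaban1983to89.B6Ineq2142KLevelV1 (β)
open Literature.MathematicalPhysics.QuantumFieldTheory.Balaban1983to89.B9FromB6 (EBlock pref4_nonneg pref6_nonneg)
open Literature.MathematicalPhysics.QuantumFieldTheory.Balaban1983to89.B9Eq39Adjoint (fluct)
open Literature.MathematicalPhysics.QuantumFieldTheory.Balaban1983to89.B9SectBCodedCarrier (CCfg pullK)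
open Literature.MathematicalPhysics.QuantumFieldTheory.Balaban1983to89.B9Eq360DeltaPrimeAY (AfldY mulY)
open Literature.MathematicalPhysics.QuantumFieldTheory.Balaban1983to89.B9PinMembersKLevelV1 (MemberY geo9Y bg9Y)
open Literature.MathematicalPhysics.QuantumFieldTheory.Balaban1983to89.B9SectBGpFrameCodedY (codingYx)
open Literature.MathematicalPhysics.QuantumFieldTheory.Balaban1983to89.B9SectBGpReadingsY (KSC)
open Literature.MathematicalPhysics.QuantumFieldTheory.Balaban1983to89.B9SectBGpTransferInY (ineq342_346_347_mono ineq343_345_congr)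
open Literature.MathematicalPhysics.QuantumFieldTheory.Balaban1983to89.Node00 (SiteY BlkY IBondY CfgY SiteParY kernelFamilyS GpY)
open Literature.MathematicalPhysics.QuantumFieldTheory.Balaban1983to89.B9GeoNormsKLevelV1 (geo9K_supNorm_nonneg geo9K_l2Norm_nonneg geo9K_wNorm_nonneg
  geo9K_cutSup_nonneg geo9K_dist_nonneg)

variable {𝔸 : Type} [NormedRing 𝔸] [NormedAlgebra ℂ 𝔸] [CompleteSpace 𝔸]
variable {d ℓ : ℕ} {hd : 1 ≤ d + 1} {hL : Odd (ℓ + 1) ∧ 1 < ℓ + 1} {b₀ b₁ : ℝ} {Mstar : ℕ}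
  (G : Subgroup 𝔸ˣ) (x : MemberY d ℓ hd hL b₀ b₁ Mstar) (par : SiteParY 𝔸 x.toKIdx) (C37 C38 : ℝ → CfgY 𝔸 x.toKIdx → AfldY 𝔸 x.toKIdx → Prop)

/-! ## §1 The members at a coded product ARE the record's at `W = U′U` -/

/-- the five untouched members of the augmented readings at the coded product `prod U a` are the record's at `W = e^{ηa}·U`.
[cite: Balaban1985BackgroundPropagators, (3.43)–(3.47) p.398, Thm 3.4 p.400, bookkeeping] -/
theorem KSC_members_prod (U : CfgY 𝔸 x.toKIdx) (a : AfldY 𝔸 x.toKIdx) :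
    (KSC G x par C37 C38).h1 (.prod U a)
        = (kernelFamilyS x.toKIdx (bg9Y 𝔸 G x) (fun U => U) (GpY x.toKIdx par) par).h1 (mulY x.toKIdx (fluct (kGeo x.toKIdx).eta a) U) ∧
    (KSC G x par C37 C38).e4 (.prod U a)
        = (kernelFamilyS x.toKIdx (bg9Y 𝔸 G x) (fun U => U) (GpY x.toKIdx par) par).e4 (mulY x.toKIdx (fluct (kGeo x.toKIdx).eta a) U) ∧
    (KSC G x par C37 C38).h2 (.prod U a)
        = (kernelFamilyS x.toKIdx (bg9Y 𝔸 G x) (fun U => U) (GpY x.toKIdx par) par).h2 (mulY x.toKIdx (fluct (kGeo x.toKIdx).eta a) U) ∧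
    (∀ n, (KSC G x par C37 C38).l2 n (.prod U a)
        = (kernelFamilyS x.toKIdx (bg9Y 𝔸 G x) (fun U => U) (GpY x.toKIdx par) par).l2 n (mulY x.toKIdx (fluct (kGeo x.toKIdx).eta a) U)) ∧
    (∀ n, (KSC G x par C37 C38).glob n (.prod U a)
        = (kernelFamilyS x.toKIdx (bg9Y 𝔸 G x) (fun U => U) (GpY x.toKIdx par) par).glob n (mulY x.toKIdx (fluct (kGeo x.toKIdx).eta a) U)) :=
  ⟨rfl, rfl, rfl, fun _ => rfl, fun _ => rfl⟩

/-- the members (all six) of the record family read along the decoding at the coded product `prod U a` are its members at `W = e^{ηa}·U`.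
[cite: Balaban1985BackgroundPropagators, (3.42)–(3.47) pp.397–398, Thm 3.4 p.400, bookkeeping] -/
theorem pullK_members_prod (K : B9.KernelFamily (geo9Y x) (bg9Y 𝔸 G x)) (U : CfgY 𝔸 x.toKIdx) (a : AfldY 𝔸 x.toKIdx) :
    (∀ n, (pullK (codingYx G x C37 C38) K).e n (.prod U a) = K.e n (mulY x.toKIdx (fluct (kGeo x.toKIdx).eta a) U)) ∧
    (pullK (codingYx G x C37 C38) K).h1 (.prod U a) = K.h1 (mulY x.toKIdx (fluct (kGeo x.toKIdx).eta a) U) ∧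
    (pullK (codingYx G x C37 C38) K).e4 (.prod U a) = K.e4 (mulY x.toKIdx (fluct (kGeo x.toKIdx).eta a) U) ∧
    (pullK (codingYx G x C37 C38) K).h2 (.prod U a) = K.h2 (mulY x.toKIdx (fluct (kGeo x.toKIdx).eta a) U) ∧
    (∀ n, (pullK (codingYx G x C37 C38) K).l2 n (.prod U a) = K.l2 n (mulY x.toKIdx (fluct (kGeo x.toKIdx).eta a) U)) ∧
    (∀ n, (pullK (codingYx G x C37 C38) K).glob n (.prod U a) = K.glob n (mulY x.toKIdx (fluct (kGeo x.toKIdx).eta a) U)) :=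
  ⟨fun _ => rfl, rfl, rfl, rfl, fun _ => rfl, fun _ => rfl⟩

/-! ## §2 `hout` reduced to the letter conversion of the (3.42) block -/

/-- the (3.42) ∕ (3.46) ∕ (3.47) block is monotone in `B₀ ≥ 0` upward AND in the rate `δ₀` downward (distances are nonnegative).
[cite: Balaban1985BackgroundPropagators, (3.42) + (3.46) + (3.47) pp.397–398, bookkeeping] -/
theorem ineq342_346_347_weaken (K : B9.KernelFamily (geo9Y x) (codingYx G x C37 C38).bg) {B₀ B₀' δ δ' : ℝ} {c : (codingYx G x C37 C38).bg.Cfg}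
    (hB0 : 0 ≤ B₀) (hle : B₀ ≤ B₀') (hδ : δ' ≤ δ) (h : B9.Ineq342_346_347 K B₀ δ c) : B9.Ineq342_346_347 K B₀' δ' c := by
  have hB0' : 0 ≤ B₀' := hB0.trans hle
  have hexp : ∀ y y' : IBondY x.toKIdx, Real.exp (-(δ * (geo9Y x).dist y y')) ≤ Real.exp (-(δ' * (geo9Y x).dist y y')) := fun y y' =>
    Real.exp_le_exp.2 (by
      have hD : 0 ≤ (geo9Y x).dist y y' := geo9K_dist_nonneg x.toKIdx y y'
      nlinarith [mul_le_mul_of_nonneg_right hδ hD])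
  refine ⟨fun n lam y y' hs => (h.1 n lam y y' hs).trans ?_, fun n lam hh y y' hc hs => (h.2.1 n lam hh y y' hc hs).trans ?_,
    (ineq342_346_347_mono G x C37 C38 K hle h).2.2⟩
  · have h1 : 0 ≤ B9.pref4 ((geo9Y x).len y) n := pref4_nonneg (B9GeoLemma21KLevelV1.geo9Y_len_pos x y).le n
    have h2 : 0 ≤ (geo9Y x).supNorm lam := geo9K_supNorm_nonneg x.toKIdx lam
    have h3 := hexp y y'
    have h4 := (Real.exp_pos (-(δ * (geo9Y x).dist y y'))).le
    have h5 : 0 ≤ B₀' * B9.pref4 ((geo9Y x).len y) n := mul_nonneg hB0' h1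
    gcongr
  · have h1 : 0 ≤ B9.pref6 ((geo9Y x).len y) n := pref6_nonneg (B9GeoLemma21KLevelV1.geo9Y_len_pos x y).le n
    have h2 : 0 ≤ (geo9Y x).l2Norm lam := geo9K_l2Norm_nonneg x.toKIdx lam
    have h3 := hexp y y'
    have h4 : 0 ≤ (geo9Y x).cutSup hh := geo9K_cutSup_nonneg x.toKIdx hh
    have h5 := (Real.exp_pos (-(δ * (geo9Y x).dist y y'))).le
    have h6 : 0 ≤ B₀' * B9.pref6 ((geo9Y x).len y) n * (geo9Y x).cutSup hh := mul_nonneg (mul_nonneg hB0' h1) h4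
    gcongr

/-- a product `P·E·N` with `0 ≤ P·E·N`, `0 < E ≤ E′` grows to `P·E′·N` (the sign of `P·N` is forced). [folklore]
[cite: Balaban1985BackgroundPropagators, (3.43)–(3.45) p.398, bookkeeping] -/
theorem mul_exp_mono {P N E E' : ℝ} (hE : 0 < E) (hEE : E ≤ E') (h0 : 0 ≤ P * E * N) : P * E * N ≤ P * E' * N := by
  have hPN : 0 ≤ P * N := by
    have h1 : 0 ≤ P * N * E := by linarith [show P * E * N = P * N * E by ring]
    exact (mul_nonneg_iff_of_pos_right hE).1 h1
  nlinarith [mul_le_mul_of_nonneg_left hEE hPN]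

/-- the Hölder block (3.43)–(3.45) is antitone in the rate `δ₀` for a family with NONNEGATIVE members at the configuration (distances are nonnegative;
the sign of the constants is forced by the members). [cite: Balaban1985BackgroundPropagators, (3.43)–(3.45) p.398, bookkeeping] -/
theorem ineq343_345_antitone (K : B9.KernelFamily (geo9Y x) (codingYx G x C37 C38).bg) {c : (codingYx G x C37 C38).bg.Cfg}
    (hn1 : ∀ lam β' ζ, 0 ≤ K.h1 c lam β' ζ) (hn4 : ∀ lam y, 0 ≤ K.e4 c lam y) (hn2 : ∀ lam β' ζ, 0 ≤ K.h2 c lam β' ζ)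
    {δ δ' : ℝ} (hδ : δ' ≤ δ) (Bβ Bε : ℝ → ℝ) (Bεβ : ℝ → ℝ → ℝ) (h : B9.Ineq343_345 K Bβ Bε Bεβ δ c) :
    B9.Ineq343_345 K Bβ Bε Bεβ δ' c := by
  have hexp : ∀ y y' : IBondY x.toKIdx, Real.exp (-(δ * (geo9Y x).dist y y')) ≤ Real.exp (-(δ' * (geo9Y x).dist y y')) := fun y y' =>
    Real.exp_le_exp.2 (by
      have hD : 0 ≤ (geo9Y x).dist y y' := geo9K_dist_nonneg x.toKIdx y y'
      nlinarith [mul_le_mul_of_nonneg_right hδ hD])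
  refine ⟨fun β' lam ζ y y' hb hb' hc hs => ?_, fun ε lam y y' hε hε' hs => ?_, fun ε β' lam ζ y y' hε hε' hb hb' hc hs => ?_⟩
  · have h1 := h.1 β' lam ζ y y' hb hb' hc hs
    exact h1.trans (mul_exp_mono (Real.exp_pos _) (hexp y y') ((hn1 lam β' ζ).trans h1))
  · have h1 := h.2.1 ε lam y y' hε hε' hs
    have h2 : Bε ε * Real.exp (-(δ * (geo9Y x).dist y y')) * ((geo9Y x).holder ε lam + (geo9Y x).supNorm lam)
        ≤ Bε ε * Real.exp (-(δ' * (geo9Y x).dist y y')) * ((geo9Y x).holder ε lam + (geo9Y x).supNorm lam) :=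
      mul_exp_mono (Real.exp_pos _) (hexp y y') ((hn4 lam y).trans h1)
    exact h1.trans h2
  · have h1 := h.2.2 ε β' lam ζ y y' hε hε' hb hb' hc hs
    exact h1.trans (mul_exp_mono (Real.exp_pos _) (hexp y y') ((hn2 lam β' ζ).trans h1))

/-- the Hölder ∕ (3.44) ∕ (3.45) members of def-Y's reading of a site-sector letter are nonnegative (suprema over the ball of nonnegative quantities, or `0`).
[cite: Balaban1985BackgroundPropagators, (3.43)–(3.45) p.398, bookkeeping] -/
theorem kernelFamilyS_members_nonneg {B : B9.Backgrounds} (cfg : B.Cfg → CfgY 𝔸 x.toKIdx) (O : Node00.SiteOpY 𝔸 x.toKIdx) (c : B.Cfg) :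
    (∀ lam β' ζ, 0 ≤ (kernelFamilyS x.toKIdx B cfg O par).h1 c lam β' ζ) ∧ (∀ lam y, 0 ≤ (kernelFamilyS x.toKIdx B cfg O par).e4 c lam y) ∧
      (∀ lam β' ζ, 0 ≤ (kernelFamilyS x.toKIdx B cfg O par).h2 c lam β' ζ) := by
  have hq : ∀ (p : SiteY x.toKIdx → SiteY x.toKIdx → 𝔸ˣ) (α : ℝ) (Ψ : SiteY x.toKIdx → 𝔸), 0 ≤ Node00.hqS x.toKIdx p α Ψ := fun p α Ψ =>
    Real.iSup_nonneg fun q => by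
      split_ifs
      · exact div_nonneg (norm_nonneg _) (Real.rpow_nonneg (div_nonneg
          (B4TorusKernel.MultiPeriod.torusSupNorm_nonneg (fun μ => B6MultiLevelTorusOperator.one_le_N0 (Node00.toKT x.toKIdx).hMh
            (Node00.toKT x.toKIdx).hP μ) _) (Nat.cast_nonneg _)) _)
      · exact le_rfl
  refine ⟨fun lam β' ζ => ?_, fun lam y => ?_, fun lam β' ζ => ?_⟩
  · cases lam with
    | inr J => exact le_rfl
    | inl f =>
      cases ζ with
      | inr z => exact le_rfl
      | inl z => exact Real.iSup_nonneg fun E => Real.iSup_nonneg fun p => by split_ifs <;> exact hq _ _ _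
  · cases lam with
    | inr J => exact le_rfl
    | inl f =>
      exact Real.iSup_nonneg fun E => Real.iSup_nonneg fun μ => Real.iSup_nonneg fun p => by split_ifs <;> positivity
  · cases lam with
    | inr J => exact le_rfl
    | inl f =>
      cases ζ with
      | inr z => exact le_rfl
      | inl z => exact Real.iSup_nonneg fun E => Real.iSup_nonneg fun μ => Real.iSup_nonneg fun ν => hq _ _ _

/-- ★★ **`hout` REDUCED TO THE LETTER CONVERSION OF THE (3.42) BLOCK**: at a coded product `prod U a` (`W = e^{ηa}·U`), the block `Thms31to33IneqAt` of
the augmented readings `KSC` with constants `(B₀, δ₀, …)` (`B₀ ≥ 0`) together with the record's (3.42) block AT `W` WITH LETTERS AT `W`,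
`EBlock (kernelFamilyS … (GpY par) par) B″ δ″ W` (`B″ ≥ 0`) — the converted block, the one analytic input — give the block of the record's family read along
the decoding at `prod U a` with constants `(max B₀ B″, min δ₀ δ″, B_β, B_ε, B_εβ, B₁, δ₁)` (the Hölder members of the `GA` family are assumed nonnegative at
the configuration — true for every reading by suprema, e.g. `kernelFamilyS_members_nonneg`).
[cite: Balaban1985BackgroundPropagators, Thm 3.4 p.400, p.403 («of course with different constants»), p.403 l.1–9, (3.42)–(3.48) pp.397–399] -/
theorem thms_pullK_prod_of_KSC (dC : ℕ) (GA : B9.KernelFamily (geo9Y x) (codingYx G x C37 C38).bg)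
    (Cinv : B9.SiteKernel (geo9Y x) (codingYx G x C37 C38).bg) {U : CfgY 𝔸 x.toKIdx} {a : AfldY 𝔸 x.toKIdx}
    (hGA1 : ∀ lam β' ζ, 0 ≤ GA.h1 (.prod U a) lam β' ζ) (hGA4 : ∀ lam y, 0 ≤ GA.e4 (.prod U a) lam y) (hGA2 : ∀ lam β' ζ, 0 ≤ GA.h2 (.prod U a) lam β' ζ)
    {B₀ δ₀ : ℝ} {Bβ Bε : ℝ → ℝ} {Bεβ : ℝ → ℝ → ℝ} {B₁ δ₁ : ℝ} (hB₀ : 0 ≤ B₀)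
    (h : B9.Thms31to33IneqAt dC (KSC G x par C37 C38) GA Cinv B₀ δ₀ Bβ Bε Bεβ B₁ δ₁ (.prod U a))
    {B'' δ'' : ℝ} (hB'' : 0 ≤ B'')
    (hconv : EBlock (kernelFamilyS x.toKIdx (bg9Y 𝔸 G x) (fun U => U) (GpY x.toKIdx par) par) B'' δ'' (mulY x.toKIdx (fluct (kGeo x.toKIdx).eta a) U)) :
    B9.Thms31to33IneqAt dC (pullK (codingYx G x C37 C38) (kernelFamilyS x.toKIdx (bg9Y 𝔸 G x) (fun U => U) (GpY x.toKIdx par) par)) GA Cinv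
      (max B₀ B'') (min δ₀ δ'') Bβ Bε Bεβ B₁ δ₁ (.prod U a) := by
  set K := kernelFamilyS x.toKIdx (bg9Y 𝔸 G x) (fun U => U) (GpY x.toKIdx par) par with hK
  set W := mulY x.toKIdx (fluct (kGeo x.toKIdx).eta a) U with hW
  obtain ⟨⟨h42, h43⟩, hC, ⟨g42, g43⟩⟩ := h
  have mK := KSC_members_prod G x par C37 C38 U a
  have mP := pullK_members_prod G x C37 C38 K U a
  have h42' := ineq342_346_347_weaken G x C37 C38 _ hB₀ (le_max_left B₀ B'') (min_le_left δ₀ δ'') h42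
  have hnn := kernelFamilyS_members_nonneg x par (B := bg9Y 𝔸 G x) (fun U => U) (GpY x.toKIdx par) W
  -- the Hölder block of the pulled-back family: the same members as `KSC`'s, then the smaller rate
  have h43P : B9.Ineq343_345 (pullK (codingYx G x C37 C38) K) Bβ Bε Bεβ δ₀ (.prod U a) :=
    ineq343_345_congr G x C37 C38 _ _ (mK.1.trans mP.2.1.symm) (mK.2.1.trans mP.2.2.1.symm) (mK.2.2.1.trans mP.2.2.2.1.symm) Bβ Bε Bεβ δ₀ h43
  have hP1 : ∀ lam β' ζ, 0 ≤ (pullK (codingYx G x C37 C38) K).h1 (.prod U a) lam β' ζ := fun lam β' ζ => by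
    show 0 ≤ K.h1 W lam β' ζ; exact hnn.1 lam β' ζ
  have hP4 : ∀ lam y, 0 ≤ (pullK (codingYx G x C37 C38) K).e4 (.prod U a) lam y := fun lam y => by
    show 0 ≤ K.e4 W lam y; exact hnn.2.1 lam y
  have hP2 : ∀ lam β' ζ, 0 ≤ (pullK (codingYx G x C37 C38) K).h2 (.prod U a) lam β' ζ := fun lam β' ζ => by
    show 0 ≤ K.h2 W lam β' ζ; exact hnn.2.2 lam β' ζ
  refine ⟨⟨⟨?_, ?_, ?_⟩, ineq343_345_antitone G x C37 C38 _ hP1 hP4 hP2 (min_le_left δ₀ δ'') Bβ Bε Bεβ h43P⟩, hC,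
    ⟨ineq342_346_347_weaken G x C37 C38 GA hB₀ (le_max_left _ _) (min_le_left _ _) g42,
      ineq343_345_antitone G x C37 C38 GA hGA1 hGA4 hGA2 (min_le_left δ₀ δ'') Bβ Bε Bεβ g43⟩⟩
  · -- (3.42): the converted block, re-read along the decoding and weakened to the common constants
    intro n lam y y' hs
    show K.e n W lam y ≤ _
    refine (hconv n lam y y' hs).trans ?_
    have h1 : 0 ≤ B9.pref4 ((geo9Y x).len y) n := pref4_nonneg (B9GeoLemma21KLevelV1.geo9Y_len_pos x y).le n
    have h2 : 0 ≤ (geo9Y x).supNorm lam := geo9K_supNorm_nonneg x.toKIdx lam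
    have h3 : Real.exp (-(δ'' * (geo9Y x).dist y y')) ≤ Real.exp (-(min δ₀ δ'' * (geo9Y x).dist y y')) :=
      Real.exp_le_exp.2 (by
        have hD : 0 ≤ (geo9Y x).dist y y' := geo9K_dist_nonneg x.toKIdx y y'
        nlinarith [mul_le_mul_of_nonneg_right (min_le_right δ₀ δ'') hD])
    have h4 := (Real.exp_pos (-(δ'' * (geo9Y x).dist y y'))).le
    have h5 : B'' ≤ max B₀ B'' := le_max_right _ _
    have h6 : 0 ≤ max B₀ B'' * B9.pref4 ((geo9Y x).len y) n := mul_nonneg (hB''.trans h5) h1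
    show B'' * B9.pref4 ((geo9Y x).len y) n * Real.exp (-(δ'' * (geo9Y x).dist y y')) * (geo9Y x).supNorm lam
        ≤ max B₀ B'' * B9.pref4 ((geo9Y x).len y) n * Real.exp (-(min δ₀ δ'' * (geo9Y x).dist y y')) * (geo9Y x).supNorm lam
    gcongr
  · intro n lam hh y y' hc hs
    show K.l2 n W lam hh ≤ _
    have e1 := congrFun (congrFun (mK.2.2.2.1 n) lam) hh
    rw [← e1]
    exact h42'.2.1 n lam hh y y' hc hs
  · intro n lam γ h4 h4'
    show K.glob n W lam γ ≤ _
    have e1 := congrFun (congrFun (mK.2.2.2.2 n) lam) γ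
    rw [← e1]
    exact h42'.2.2 n lam γ h4 h4'

/-! ## §3 The left letter at `W = U′U` against the left letter at `U`, pointwise ((3.70), first step of the conversion) -/

section LeftLetter

open Literature.MathematicalPhysics.QuantumFieldTheory.Balaban1983to89.B9Eq39Adjoint (R R_mul)
open Literature.MathematicalPhysics.QuantumFieldTheory.Balaban1983to89.B9SectBGpLettersY (GVal norm_le_one_and_inv_of_mem)
open Literature.MathematicalPhysics.QuantumFieldTheory.Balaban1983to89.Node00 (UboxY shiftY cdS)

omit [NormedAlgebra ℂ 𝔸] [CompleteSpace 𝔸] in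
/-- the transport defect of one bond variable: `‖R(u)X − X‖ ≦ (‖u − 1‖·‖u⁻¹‖ + ‖u⁻¹ − 1‖)·‖X‖` (`R(u)X − X = (u−1)Xu⁻¹ + X(u⁻¹−1)`).
[cite: Balaban1985BackgroundPropagators, (3.70) p.404, (3.37) p.396, bookkeeping] -/
theorem norm_R_sub_self_le (u : 𝔸ˣ) (X : 𝔸) :
    ‖R u X - X‖ ≤ (‖(u : 𝔸) - 1‖ * ‖((u⁻¹ : 𝔸ˣ) : 𝔸)‖ + ‖((u⁻¹ : 𝔸ˣ) : 𝔸) - 1‖) * ‖X‖ := by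
  have h : R u X - X = ((u : 𝔸) - 1) * X * ((u⁻¹ : 𝔸ˣ) : 𝔸) + X * (((u⁻¹ : 𝔸ˣ) : 𝔸) - 1) := by
    simp only [R, sub_mul, mul_sub, one_mul, mul_one]; abel
  rw [h]
  calc ‖((u : 𝔸) - 1) * X * ((u⁻¹ : 𝔸ˣ) : 𝔸) + X * (((u⁻¹ : 𝔸ˣ) : 𝔸) - 1)‖
      ≤ ‖((u : 𝔸) - 1) * X * ((u⁻¹ : 𝔸ˣ) : 𝔸)‖ + ‖X * (((u⁻¹ : 𝔸ˣ) : 𝔸) - 1)‖ := norm_add_le _ _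
    _ ≤ ‖(u : 𝔸) - 1‖ * ‖X‖ * ‖((u⁻¹ : 𝔸ˣ) : 𝔸)‖ + ‖X‖ * ‖((u⁻¹ : 𝔸ˣ) : 𝔸) - 1‖ :=
        add_le_add ((norm_mul_le _ _).trans (mul_le_mul_of_nonneg_right (norm_mul_le _ _) (norm_nonneg _))) (norm_mul_le _ _)
    _ = _ := by ring

/-- ★ **THE LEFT LETTER AT `W = U′U`, POINTWISE**: `(∇_{W,μ}g)(z) = (∇_{U,μ}g)(z) + (R(U′_μ(z)) − 1)(R(U_μ(z))g(z+e_μ))` — the bond variables of the product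
multiply pointwise and the transport is multiplicative (`R(u′u) = R(u′)R(u)`). [cite: Balaban1985BackgroundPropagators, (3.70) p.404, p.403 l.1–9] -/
theorem cdS_mulY_apply (U' U : CfgY 𝔸 x.toKIdx) (μ : Fin (d + 1)) (g : SiteY x.toKIdx → 𝔸) (z : SiteY x.toKIdx) :
    cdS x.toKIdx (mulY x.toKIdx U' U) μ g z
      = cdS x.toKIdx U μ g z
        + (R (UboxY x.toKIdx U' μ z) (R (UboxY x.toKIdx U μ z) (g (shiftY x.toKIdx μ z))) - R (UboxY x.toKIdx U μ z) (g (shiftY x.toKIdx μ z))) := by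
  show R (UboxY x.toKIdx U' μ z * UboxY x.toKIdx U μ z) (g (shiftY x.toKIdx μ z)) - g z = R (UboxY x.toKIdx U μ z) (g (shiftY x.toKIdx μ z)) - g z + _
  rw [B9Eq39Adjoint.R_mul]
  abel

/-- ★ **THE LEFT LETTER CONVERSION, POINTWISE NORM FORM**: at a `G`-valued base `U`,
`η‖(∇_{U′U,μ}g)(z)‖ ≦ η‖(∇_{U,μ}g)(z)‖ + η·(‖U′_μ(z) − 1‖·‖U′_μ(z)⁻¹‖ + ‖U′_μ(z)⁻¹ − 1‖)·‖g(z + e_μ)‖` — the defect is read by the (3.42) FIRST entry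
at the neighbour block, its coefficient by (3.37) at the OUTPUT bond. [cite: Balaban1985BackgroundPropagators, (3.70) p.404, (3.37) p.396, (3.42) p.397] -/
theorem eta_mul_norm_cdS_mulY_le (hG1 : ∀ u : 𝔸ˣ, u ∈ G → ‖(u : 𝔸)‖ ≤ 1) {U : CfgY 𝔸 x.toKIdx} (hU : GVal G x.toKIdx U) (U' : CfgY 𝔸 x.toKIdx)
    (μ : Fin (d + 1)) (g : SiteY x.toKIdx → 𝔸) (z : SiteY x.toKIdx) {η : ℝ} (hη : 0 ≤ η) :
    η * ‖cdS x.toKIdx (mulY x.toKIdx U' U) μ g z‖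
      ≤ η * ‖cdS x.toKIdx U μ g z‖
        + η * (‖((UboxY x.toKIdx U' μ z : 𝔸ˣ) : 𝔸) - 1‖ * ‖(((UboxY x.toKIdx U' μ z)⁻¹ : 𝔸ˣ) : 𝔸)‖
            + ‖(((UboxY x.toKIdx U' μ z)⁻¹ : 𝔸ˣ) : 𝔸) - 1‖) * ‖g (shiftY x.toKIdx μ z)‖ := by
  have hu := norm_le_one_and_inv_of_mem G hG1 (hU μ _ : UboxY x.toKIdx U μ z ∈ G)
  rw [cdS_mulY_apply x U' U μ g z]
  have hY : ‖R (UboxY x.toKIdx U μ z) (g (shiftY x.toKIdx μ z))‖ ≤ ‖g (shiftY x.toKIdx μ z)‖ := by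
    have h := B9Eq371Composition.norm_R_le_sq (UboxY x.toKIdx U μ z) hu.1 hu.2 (g (shiftY x.toKIdx μ z))
    rwa [one_pow, one_mul] at h
  have hdef := (norm_R_sub_self_le (UboxY x.toKIdx U' μ z) (R (UboxY x.toKIdx U μ z) (g (shiftY x.toKIdx μ z)))).trans
    (mul_le_mul_of_nonneg_left hY (by positivity))
  calc η * ‖cdS x.toKIdx U μ g z + (R (UboxY x.toKIdx U' μ z) (R (UboxY x.toKIdx U μ z) (g (shiftY x.toKIdx μ z)))
          - R (UboxY x.toKIdx U μ z) (g (shiftY x.toKIdx μ z)))‖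
      ≤ η * (‖cdS x.toKIdx U μ g z‖ + ‖R (UboxY x.toKIdx U' μ z) (R (UboxY x.toKIdx U μ z) (g (shiftY x.toKIdx μ z)))
          - R (UboxY x.toKIdx U μ z) (g (shiftY x.toKIdx μ z))‖) := mul_le_mul_of_nonneg_left (norm_add_le _ _) hη
    _ ≤ η * (‖cdS x.toKIdx U μ g z‖ + (‖((UboxY x.toKIdx U' μ z : 𝔸ˣ) : 𝔸) - 1‖ * ‖(((UboxY x.toKIdx U' μ z)⁻¹ : 𝔸ˣ) : 𝔸)‖
            + ‖(((UboxY x.toKIdx U' μ z)⁻¹ : 𝔸ˣ) : 𝔸) - 1‖) * ‖g (shiftY x.toKIdx μ z)‖) := by gcongr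
    _ = _ := by ring

end LeftLetter

end Literature.MathematicalPhysics.QuantumFieldTheory.Balaban1983to89.B9SectBGpTransferOutY
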